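import Literature.AlgebraicTopology.SingularHomology.SphereLikeFibre
import Literature.AlgebraicTopology.CharacteristicClasses.ProjectiveLineSphereLike
import Literature.AlgebraicTopology.CharacteristicClasses.ProjectiveCompletion
import Literature.AlgebraicTopology.CharacteristicClasses.ProjectivizationHomotopy
import HarnessLib

/-!
# Local Thom classes of a complex line bundle on its projective completion `P(λ ⊕ ℂ)`

D. Husemoller, *Fibre Bundles* (3rd ed. 1994), Ch. 17 §2–§3 with Milnor–Stasheff §9–§10 / §14
(the Thom class `u ∈ H²(E, E₀)` of an oriented `2`-plane bundle, "whose restriction to each fibre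
is the preferred generator", Thm. 9.1/10.4) — here for a complex LINE bundle `λ` in the ABSOLUTE
form on the projective completion `D = P(λ ⊕ ℂ)` (`ProjectiveCompletion`): a class
`t ∈ H²(D_S)` over `S ⊆ B` is **normalised** (`IsNormalised`) if it vanishes along the section at
infinity and restricts on every fibre `ℙ(λ_b ⊕ ℂ) ≅ ℂP¹` to the canonical generator `ω_b`.

## Content (all proved; coefficients `M` over `R`, generator parameter `m ∈ M`)

* `modelDualPair`, **`modelSphereLike hF`** — for `dim F = 1` the fibre model `ℙ(F ⊕ ℂ)` is
  sphere-like (`ProjectiveLineSphereLike`) w.r.t. the charts `{ψ ∘ pr₁ ≠ 0} ∋ [f₀ : 0]`,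
  `{pr₂ ≠ 0} ∋ [0 : 1]`;
* `omegaModel m ∈ H²(ℙ(F ⊕ ℂ))`, `omegaFib b m ∈ H²(ℙ(λ_b ⊕ ℂ))` (transport along the canonical
  chart `λ_b ≅ F`) and **`map_projProd_omegaModel`**: EVERY linear isomorphism `λ_b ≅ F` transports
  `ω` to `ω_b` (two differ by an automorphism of the line `F`, which acts trivially:
  `ProjectivizationHomotopy.map_projProdOne_eq_id`);
* `localThomClass e hS m ∈ H²(D_S; M)` for `S` inside the base set of an atlas trivialisation `e`
  (pull back `ω_S(m) = sphereMap (0, m·1)` along `D_S ≅ S × ℙ(F ⊕ ℂ)`), and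
  **`isNormalised_localThomClass`**;
* **`eq_zero_of_isNormalisedZero`** — over such `S`, a class of `H²(D_S)` killed by the section at
  infinity and by all fibres is zero (`SphereLikeFibre.eq_zero_of_forall_map_fibreIncl_eq_zero`);
  hence **`IsNormalised.unique`**: two normalised classes over a trivialisable `S` coincide;
* restriction to `S' ⊆ S` preserves normalisation (`IsNormalised.restrict`).

## References

* D. Husemoller, *Fibre Bundles*, GTM 20, Springer 1994, Ch. 17 §2–§3. [HusemollerFibreBundles1994]
* J. Milnor, J. Stasheff, *Characteristic Classes*, PUP 1974, §9 Thm. 9.1, §14 p. 158. [MilnorStasheff1974]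
-/

noncomputable section

open CategoryTheory Function Set Bundle Literature.AlgebraicTopology.SingularHomology
open scoped LinearAlgebra.Projectivization

universe u w

namespace Literature.AlgebraicTopology.CharacteristicClasses

/-! ### The fibre model `ℙ(F ⊕ ℂ)` of a line is sphere-like -/

section Model

variable (F : Type u) [NormedAddCommGroup F] [NormedSpace ℂ F] (hF : Module.finrank ℂ F = 1)
include hF

omit hF in
/-- A continuous functional `ψ` of the line `F` with `ψ f₀ = 1`. [folklore] -/
def modelFunctional (hF : Module.finrank ℂ F = 1) : F →L[ℂ] ℂ :=
  haveI : FiniteDimensional ℂ F := Module.finite_of_finrank_eq_succ hF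
  let φ := chartFunctional ℂ F (Projectivization.mk ℂ (modelVec F hF) (modelVec_ne_zero F hF))
  (φ (modelVec F hF))⁻¹ • φ

/-- `ψ f₀ = 1`. [folklore] -/
theorem modelFunctional_modelVec : modelFunctional F hF (modelVec F hF) = 1 := by
  haveI : FiniteDimensional ℂ F := Module.finite_of_finrank_eq_succ hF
  have hne : chartFunctional ℂ F (Projectivization.mk ℂ (modelVec F hF) (modelVec_ne_zero F hF)) (modelVec F hF) ≠ 0 :=
    (mk_mem_chartDomain_iff _ _ _).1 (mem_chartDomain_chartFunctional ℂ F _)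
  change (chartFunctional ℂ F _ (modelVec F hF))⁻¹ * chartFunctional ℂ F _ (modelVec F hF) = 1
  exact inv_mul_cancel₀ hne

/-- Every vector of the line is `ψ(x) f₀`. [folklore] -/
theorem eq_modelFunctional_smul (x : F) : x = modelFunctional F hF x • modelVec F hF := by
  obtain ⟨c, rfl⟩ := (finrank_eq_one_iff_of_nonzero' (modelVec F hF) (modelVec_ne_zero F hF)).1 hF x
  rw [map_smul, modelFunctional_modelVec, smul_eq_mul, mul_one]

omit hF in
/-- The first chart functional `ψ ∘ pr₁` of the fibre model. [folklore] -/
abbrev modelφ₁ (hF : Module.finrank ℂ F = 1) : F × ℂ →L[ℂ] ℂ :=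
  (modelFunctional F hF).comp (ContinuousLinearMap.fst ℂ F ℂ)

omit hF in
/-- The second chart functional `pr₂` of the fibre model. [folklore] -/
abbrev modelφ₂ : F × ℂ →L[ℂ] ℂ := ContinuousLinearMap.snd ℂ F ℂ

/-- **The dual pair `(ψ ∘ pr₁, pr₂; (f₀, 0), (0, 1))` of `F ⊕ ℂ`.** [folklore] -/
theorem modelDualPair :
    IsDualPair (modelφ₁ F hF) (modelφ₂ F) ((modelVec F hF, 0) : F × ℂ) ((0, 1) : F × ℂ) where
  apply₁₁ := by simp [modelFunctional_modelVec]
  apply₁₂ := by simp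
  apply₂₁ := by simp
  apply₂₂ := by simp
  eq_add := by
    rintro ⟨x, t⟩
    refine Prod.ext ?_ ?_
    · change x = modelFunctional F hF x • modelVec F hF + t • (0 : F)
      rw [smul_zero, add_zero]
      exact eq_modelFunctional_smul F hF x
    · change t = modelFunctional F hF x • (0 : ℂ) + t • (1 : ℂ)
      rw [smul_zero, zero_add, smul_eq_mul, mul_one]

omit hF in
/-- The first chart `{ψ ∘ pr₁ ≠ 0} ∋ [f₀ : 0]` of the fibre model. [folklore] -/
abbrev modelA₁ (hF : Module.finrank ℂ F = 1) : Set (ℙ ℂ (F × ℂ)) := chartDomain (modelφ₁ F hF : Module.Dual ℂ (F × ℂ))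

omit hF in
/-- The second chart `{pr₂ ≠ 0} ∋ [0 : 1]` of the fibre model. [folklore] -/
abbrev modelA₂ : Set (ℙ ℂ (F × ℂ)) := chartDomain (modelφ₂ F : Module.Dual ℂ (F × ℂ))

/-- **`ℙ(F ⊕ ℂ)` is sphere-like for a line `F`** (w.r.t. the two charts and the circle-like structure
of their intersection `≅ ℂ^×`). [cite: HusemollerFibreBundles1994, Ch. 17 §2] -/
theorem modelSphereLike :
    IsSphereLike (ℙ ℂ (F × ℂ)) (modelA₁ F hF) (modelA₂ F)
      ((modelDualPair F hF).interChartHomeomorph ⁻¹' Cstar.left)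
      ((modelDualPair F hF).interChartHomeomorph ⁻¹' Cstar.right)
      ((modelDualPair F hF).interChartHomeomorph ⁻¹' Cstar.upper)
      ((modelDualPair F hF).interChartHomeomorph ⁻¹' Cstar.lower) :=
  (modelDualPair F hF).isSphereLike

/-- The point at infinity `[f₀ : 0]` lies in the first chart. [folklore] -/
theorem infPt_mem_modelA₁ : infPt (modelVec F hF) (modelVec_ne_zero F hF) ∈ modelA₁ F hF :=
  (modelDualPair F hF).mk_left_mem

/-- Every point at infinity `[u : 0]`, `u ≠ 0`, lies in the first chart (`ψ u ≠ 0` on the line). [folklore] -/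
theorem infPt_mem_modelA₁_of_ne_zero {u : F} (hu : u ≠ 0) : infPt u hu ∈ modelA₁ F hF := by
  rw [infPt, mk_mem_chartDomain_iff]
  intro h0
  apply hu
  rw [eq_modelFunctional_smul F hF u, show modelFunctional F hF u = 0 from h0, zero_smul]

omit hF in
/-- The origin `[0 : 1]` lies in the second chart. [folklore] -/
theorem zeroPt_mem_modelA₂ : zeroPt F ∈ modelA₂ F := by
  rw [zeroPt, mk_mem_chartDomain_iff]
  exact one_ne_zero

variable (R : Type w) [CommRing R] (M : Type w) [AddCommGroup M] [Module R M]

/-- **The canonical generator `ω(m) ∈ H²(ℙ(F ⊕ ℂ); M)`** of the fibre model. [cite: MilnorStasheff1974, §14 p. 158] -/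
def omegaModel (m : M) : singularCohomology R M (ℙ ℂ (F × ℂ)) 2 := (modelSphereLike F hF).omegaFibre R M m

/-- `ℙ(φ × 𝟙) : ℙ(V ⊕ ℂ) → ℙ(F ⊕ ℂ)` for a linear isomorphism `φ : V ≅ F`, as a continuous map. [folklore] -/
abbrev projProd {V : Type u} [AddCommGroup V] [Module ℂ V] [TopologicalSpace V] (φ : V ≃L[ℂ] F) :
    C(ℙ ℂ (V × ℂ), ℙ ℂ (F × ℂ)) :=
  (homeomorphOfContinuousLinearEquiv (φ.prodCongr (ContinuousLinearEquiv.refl ℂ ℂ)) : C(ℙ ℂ (V × ℂ), ℙ ℂ (F × ℂ)))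

omit hF in
/-- `ℙ(φ × 𝟙) : ℙ(V₁ ⊕ ℂ) → ℙ(V₂ ⊕ ℂ)` for a linear isomorphism between arbitrary spaces, as a continuous map. [folklore] -/
abbrev projProd₂ {V₁ V₂ : Type u} [AddCommGroup V₁] [Module ℂ V₁] [TopologicalSpace V₁]
    [AddCommGroup V₂] [Module ℂ V₂] [TopologicalSpace V₂] (φ : V₁ ≃L[ℂ] V₂) : C(ℙ ℂ (V₁ × ℂ), ℙ ℂ (V₂ × ℂ)) :=
  (homeomorphOfContinuousLinearEquiv (φ.prodCongr (ContinuousLinearEquiv.refl ℂ ℂ)) : C(ℙ ℂ (V₁ × ℂ), ℙ ℂ (V₂ × ℂ)))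

omit hF in
/-- `ℙ((A ∘ φ) × 𝟙) = ℙ(A × 𝟙) ∘ ℙ(φ × 𝟙)`. [folklore] -/
theorem projProd_trans {V₁ V₂ : Type u} [AddCommGroup V₁] [Module ℂ V₁] [TopologicalSpace V₁]
    [AddCommGroup V₂] [Module ℂ V₂] [TopologicalSpace V₂] (φ : V₁ ≃L[ℂ] V₂) (A : V₂ ≃L[ℂ] F) :
    projProd F (φ.trans A) = (projProd F A).comp (projProd₂ φ) := by
  ext p
  induction p using Projectivization.ind with
  | h v hv => rfl

/-- **Every automorphism `A` of the line acts trivially: `ℙ(A × 𝟙)^* ω = ω`.** [cite: HusemollerFibreBundles1994, Ch. 17 §3] -/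
theorem map_projProd_self (A : F ≃L[ℂ] F) (m : M) :
    singularCohomology.map R M (projProd F A) 2 (omegaModel F hF R M m) = omegaModel F hF R M m := by
  rw [map_projProdOne_eq_id R M hF A (projProd F A) rfl 2]
  rfl

end Model

/-! ### The fibre classes `ω_b` -/

section Fibre

variable {B : Type u} [TopologicalSpace B] (F : Type u) [NormedAddCommGroup F] [NormedSpace ℂ F]
  (E : B → Type u) [∀ b, AddCommGroup (E b)] [∀ b, Module ℂ (E b)]
  [TopologicalSpace (TotalSpace F E)] [∀ b, TopologicalSpace (E b)] [FiberBundle F E] [VectorBundle ℂ F E]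
  (hF : Module.finrank ℂ F = 1)
  (R : Type w) [CommRing R] (M : Type w) [AddCommGroup M] [Module R M]

/-- The fixed model line `ULift ℂ` (in the universe of the fibres) is a line. [folklore] -/
theorem finrank_model : Module.finrank ℂ (ULift.{u} ℂ) = 1 := by
  rw [finrank_ulift, Module.finrank_self]

/-- **A fixed isomorphism `F ≅ ULift ℂ` of the model line with THE model line.** [folklore] -/
def stdEquiv : F ≃L[ℂ] ULift.{u} ℂ :=
  haveI : FiniteDimensional ℂ F := Module.finite_of_finrank_eq_succ hF
  ContinuousLinearEquiv.ofFinrankEq (by rw [hF, finrank_model])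

/-- **The canonical generator `ω(m) ∈ H²(ℙ(ℂ ⊕ ℂ); M)`** (fixed model line `ULift ℂ`). [cite: MilnorStasheff1974, §14 p. 158] -/
def omegaStd (m : M) : singularCohomology R M (ℙ ℂ (ULift.{u} ℂ × ℂ)) 2 := omegaModel (ULift.{u} ℂ) finrank_model R M m

/-- The image `[f₀' : 0]` in the fixed model of the point at infinity `[f₀ : 0]`. [folklore] -/
def stdInfPt : ℙ ℂ (ULift.{u} ℂ × ℂ) :=
  infPt (stdEquiv F hF (modelVec F hF)) ((stdEquiv F hF).map_ne_zero_iff.2 (modelVec_ne_zero F hF))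

/-- `[f₀' : 0]` lies in the first chart of the fixed model. [folklore] -/
theorem stdInfPt_mem : stdInfPt F hF ∈ modelA₁ (ULift.{u} ℂ) finrank_model :=
  infPt_mem_modelA₁_of_ne_zero (ULift.{u} ℂ) finrank_model _

/-- **The canonical generator `ω_b(m) ∈ H²(ℙ(λ_b ⊕ ℂ); M)` of the fibre over `b`**: transport of
`ω(m)` along `λ_b ≅ F ≅ ULift ℂ` (canonical chart, fixed model isomorphism).
[cite: MilnorStasheff1974, §14 p. 158] -/
def omegaFib (b : B) (m : M) : singularCohomology R M (ℙ ℂ (E b × ℂ)) 2 :=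
  singularCohomology.map R M
    (projProd (ULift.{u} ℂ) ((linEquivAt ℂ F E (trivializationAt F E b) b).trans (stdEquiv F hF))) 2 (omegaStd R M m)

/-- **`ω_b` does not depend on any choice**: for EVERY linear isomorphism `χ : λ_b ≅ ULift ℂ`,
`ℙ(χ × 𝟙)^* ω = ω_b` (two differ by an automorphism of the line, acting trivially).
[cite: HusemollerFibreBundles1994, Ch. 17 §3] -/
theorem map_projProd_omegaStd (b : B) (χ : E b ≃L[ℂ] ULift.{u} ℂ) (m : M) :
    singularCohomology.map R M (projProd (ULift.{u} ℂ) χ) 2 (omegaStd R M m) = omegaFib F E hF R M b m := by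
  set χ₀ := (linEquivAt ℂ F E (trivializationAt F E b) b).trans (stdEquiv F hF)
  have hχ : χ = χ₀.trans (χ₀.symm.trans χ) := by ext v; simp
  rw [hχ, projProd_trans, singularCohomology.map_comp, ModuleCat.comp_apply, omegaStd, map_projProd_self]
  rfl

/-- In particular for `χ = φ ≫ (F ≅ ULift ℂ)` with ANY `φ : λ_b ≅ F`. [folklore] -/
theorem map_projProd_omegaModel (b : B) (φ : E b ≃L[ℂ] F) (m : M) :
    singularCohomology.map R M (projProd (ULift.{u} ℂ) (φ.trans (stdEquiv F hF))) 2 (omegaStd R M m) =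
      omegaFib F E hF R M b m :=
  map_projProd_omegaStd F E hF R M b _ m

end Fibre

/-! ### Normalised classes on `P(λ ⊕ ℂ)|_S` and the local Thom classes -/

section Local

variable {B : Type u} [TopologicalSpace B] (F : Type u) [NormedAddCommGroup F] [NormedSpace ℂ F] [FiniteDimensional ℂ F]
  (E : B → Type u) [∀ b, AddCommGroup (E b)] [∀ b, Module ℂ (E b)]
  [TopologicalSpace (TotalSpace F E)] [∀ b, TopologicalSpace (E b)] [FiberBundle F E] [VectorBundle ℂ F E]
  (hF : Module.finrank ℂ F = 1)
  (R : Type w) [CommRing R] (M : Type w) [AddCommGroup M] [Module R M]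

/-- The section at infinity over `S`, `↥S → P(λ ⊕ ℂ)|_S`. [folklore] -/
def complInfOn (S : Set B) : C(↥S, ↥(complPreimage F E S)) where
  toFun b := ⟨complInf F E hF b, b.2⟩
  continuous_toFun := ((complInf F E hF).continuous.comp continuous_subtype_val).subtype_mk _

omit hF in
variable {F E} in
/-- The fibre `ℙ(λ_b ⊕ ℂ) → P(λ ⊕ ℂ)|_S` over `b ∈ S`. [folklore] -/
def complFibOn {S : Set B} {b : B} (hb : b ∈ S) : C(ℙ ℂ (E b × ℂ), ↥(complPreimage F E S)) where
  toFun ℓ := ⟨⟨b, ℓ⟩, hb⟩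
  continuous_toFun := (complFibreIncl F E b).continuous.subtype_mk _

variable {F E} in
/-- The inclusion `P(λ ⊕ ℂ)|_{S'} → P(λ ⊕ ℂ)|_S` for `S' ⊆ S`. [folklore] -/
def complPreimageIncl {S' S : Set B} (h : S' ⊆ S) : C(↥(complPreimage F E S'), ↥(complPreimage F E S)) :=
  ⟨Set.inclusion (preimage_mono h), continuous_inclusion _⟩

/-- **Normalised classes** over `S ⊆ B`: a class `x ∈ H²(P(λ ⊕ ℂ)|_S; M)` killed by the section at
infinity and restricting to the canonical generator `ω_b(m)` on every fibre (Milnor–Stasheff §9/§10: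
the defining property of the Thom class, "restriction to each fibre is the preferred generator",
plus the normalisation `s_∞^* x = 0` that singles out the Thom class inside `H²` of the projective
completion). [cite: MilnorStasheff1974, §9 Thm. 9.1] -/
structure IsNormalised (S : Set B) (m : M) (x : singularCohomology R M ↥(complPreimage F E S) 2) : Prop where
  map_complInfOn : singularCohomology.map R M (complInfOn F E hF S) 2 x = 0
  map_complFibOn : ∀ (b : B) (hb : b ∈ S),
    singularCohomology.map R M (complFibOn hb) 2 x = omegaFib F E hF R M b m

variable {F E R M}

/-- The difference of two normalised classes is killed by the section at infinity and by all fibres. [folklore] -/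
theorem IsNormalised.sub {S : Set B} {m : M} {x x' : singularCohomology R M ↥(complPreimage F E S) 2}
    (hx : IsNormalised F E hF R M S m x) (hx' : IsNormalised F E hF R M S m x') :
    singularCohomology.map R M (complInfOn F E hF S) 2 (x - x') = 0 ∧
      ∀ (b : B) (hb : b ∈ S), singularCohomology.map R M (complFibOn hb) 2 (x - x') = 0 :=
  ⟨by rw [map_sub, hx.map_complInfOn, hx'.map_complInfOn, sub_zero],
    fun b hb ↦ by rw [map_sub, hx.map_complFibOn b hb, hx'.map_complFibOn b hb, sub_self]⟩

/-- **Normalisation restricts**: the restriction of a normalised class to `S' ⊆ S` is normalised. [folklore] -/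
theorem IsNormalised.restrict {S' S : Set B} (h : S' ⊆ S) {m : M} {x : singularCohomology R M ↥(complPreimage F E S) 2}
    (hx : IsNormalised F E hF R M S m x) :
    IsNormalised F E hF R M S' m (singularCohomology.map R M (complPreimageIncl h) 2 x) where
  map_complInfOn := by
    have hc : (complPreimageIncl (F := F) (E := E) h).comp (complInfOn F E hF S') =
        (complInfOn F E hF S).comp ⟨Set.inclusion h, continuous_inclusion h⟩ := rfl
    rw [← ModuleCat.comp_apply, ← singularCohomology.map_comp, hc, singularCohomology.map_comp,
      ModuleCat.comp_apply, hx.map_complInfOn, map_zero]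
  map_complFibOn b hb := by
    have hc : (complPreimageIncl (F := F) (E := E) h).comp (complFibOn hb) = complFibOn (h hb) := rfl
    rw [← ModuleCat.comp_apply, ← singularCohomology.map_comp, hc, hx.map_complFibOn b (h hb)]

variable (R M)
variable (e : Trivialization F (π F E)) [MemTrivializationAtlas e]

/-- **The standard local product structure `P(λ ⊕ ℂ)|_S ≃ₜ S × ℙ(ℂ ⊕ ℂ)`** over `S ⊆ U_e`: the local
product structure of `e` followed by the fixed identification `F ≅ ULift ℂ` on the fibre coordinate.
[cite: HusemollerFibreBundles1994, Ch. 17 Def. 2.1] -/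
def stdLocalHomeomorph {S : Set B} (hS : S ⊆ e.baseSet) :
    ↥(complPreimage F E S) ≃ₜ ↥S × ℙ ℂ (ULift.{u} ℂ × ℂ) :=
  (complLocalHomeomorph e hS).trans ((Homeomorph.refl ↥S).prodCongr
    (homeomorphOfContinuousLinearEquiv ((stdEquiv F hF).prodCongr (ContinuousLinearEquiv.refl ℂ ℂ))))

/-- The standard local product structure on the fibre over `b ∈ S`. [folklore] -/
theorem stdLocalHomeomorph_apply_mk {S : Set B} (hS : S ⊆ e.baseSet) {b : B} (hb : b ∈ S) (ℓ : ℙ ℂ (E b × ℂ)) :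
    stdLocalHomeomorph hF e hS ⟨⟨b, ℓ⟩, hb⟩ =
      (⟨b, hb⟩, projProd (ULift.{u} ℂ) ((linEquivAt ℂ F E e b).trans (stdEquiv F hF)) ℓ) := by
  change ((Homeomorph.refl ↥S).prodCongr
    (homeomorphOfContinuousLinearEquiv ((stdEquiv F hF).prodCongr (ContinuousLinearEquiv.refl ℂ ℂ))))
      (complLocalHomeomorph e hS ⟨⟨b, ℓ⟩, hb⟩) = _
  rw [complLocalHomeomorph_apply_mk e hS hb]
  refine Prod.ext rfl ?_
  induction ℓ using Projectivization.ind with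
  | h v hv => rfl

/-- **The local Thom class over `S ⊆ U_e`**: the pull-back of `ω_S(m) = sphereMap (0, m·1)` along the
standard local product structure `P(λ ⊕ ℂ)|_S ≅ S × ℙ(ℂ ⊕ ℂ)`. [cite: MilnorStasheff1974, §9 Thm. 9.1] -/
def localThomClass {S : Set B} (hS : S ⊆ e.baseSet) (m : M) : singularCohomology R M ↥(complPreimage F E S) 2 :=
  singularCohomology.map R M (stdLocalHomeomorph hF e hS : C(↥(complPreimage F E S), ↥S × ℙ ℂ (ULift.{u} ℂ × ℂ))) 2
    ((modelSphereLike (ULift.{u} ℂ) finrank_model).omegaProd R M ↥S m)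

variable {R M}

/-- In the standard local product structure the section at infinity is the constant slice `[f₀' : 0]`,
`f₀'` the image of `f₀` in `ULift ℂ`. [folklore] -/
theorem stdLocalHomeomorph_comp_complInfOn {S : Set B} (hS : S ⊆ e.baseSet) :
    (stdLocalHomeomorph hF e hS : C(↥(complPreimage F E S), ↥S × ℙ ℂ (ULift.{u} ℂ × ℂ))).comp (complInfOn F E hF S) =
      sliceAt (stdInfPt F hF) := by
  ext1 b
  change ((Homeomorph.refl ↥S).prodCongr
    (homeomorphOfContinuousLinearEquiv ((stdEquiv F hF).prodCongr (ContinuousLinearEquiv.refl ℂ ℂ))))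
      (complLocalHomeomorph e hS (⟨complInf F E hF b, b.2⟩ : complPreimage F E S)) = (b, stdInfPt F hF)
  rw [complLocalHomeomorph_complInf e hF hS b.2]
  rfl

/-- In the standard local product structure the fibre over `b` is the fibre slice composed with
`ℙ((e_b ≫ std) × 𝟙)`. [folklore] -/
theorem stdLocalHomeomorph_comp_complFibOn {S : Set B} (hS : S ⊆ e.baseSet) {b : B} (hb : b ∈ S) :
    (stdLocalHomeomorph hF e hS : C(↥(complPreimage F E S), ↥S × ℙ ℂ (ULift.{u} ℂ × ℂ))).comp (complFibOn hb) =
      (fibreIncl (⟨b, hb⟩ : ↥S)).comp (projProd (ULift.{u} ℂ) ((linEquivAt ℂ F E e b).trans (stdEquiv F hF))) := by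
  ext1 ℓ
  exact stdLocalHomeomorph_apply_mk hF e hS hb ℓ

/-- **The local Thom class is normalised.** [cite: MilnorStasheff1974, §9 Thm. 9.1] -/
theorem isNormalised_localThomClass {S : Set B} (hS : S ⊆ e.baseSet) (m : M) :
    IsNormalised F E hF R M S m (localThomClass hF R M e hS m) where
  map_complInfOn := by
    rw [localThomClass, ← ModuleCat.comp_apply, ← singularCohomology.map_comp,
      stdLocalHomeomorph_comp_complInfOn hF e hS]
    exact (modelSphereLike (ULift.{u} ℂ) finrank_model).map_sliceAt_omegaProd R M (stdInfPt_mem F hF) m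
  map_complFibOn b hb := by
    rw [localThomClass, ← ModuleCat.comp_apply, ← singularCohomology.map_comp,
      stdLocalHomeomorph_comp_complFibOn hF e hS hb, singularCohomology.map_comp, ModuleCat.comp_apply,
      (modelSphereLike (ULift.{u} ℂ) finrank_model).map_fibreIncl_omegaProd R M]
    exact map_projProd_omegaModel F E hF R M b (linEquivAt ℂ F E e b) m

/-- **Fibre detection over a trivialisable `S`**: a class of `H²(P(λ ⊕ ℂ)|_S; M)` killed by the section
at infinity and by every fibre vanishes (transport to `S × ℙ(ℂ ⊕ ℂ)` and
`SphereLikeFibre.eq_zero_of_forall_map_fibreIncl_eq_zero`). [cite: MilnorStasheff1974, §10 Thm. 10.4] -/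
theorem eq_zero_of_map_complInfOn_eq_zero {S : Set B} (hS : S ⊆ e.baseSet)
    (x : singularCohomology R M ↥(complPreimage F E S) 2)
    (hinf : singularCohomology.map R M (complInfOn F E hF S) 2 x = 0)
    (hfib : ∀ (b : B) (hb : b ∈ S), singularCohomology.map R M (complFibOn hb) 2 x = 0) : x = 0 := by
  set y := singularCohomology.map R M
    ((stdLocalHomeomorph hF e hS).symm : C(↥S × ℙ ℂ (ULift.{u} ℂ × ℂ), ↥(complPreimage F E S))) 2 x with hy
  have hy0 : y = 0 := by
    refine (modelSphereLike (ULift.{u} ℂ) finrank_model).eq_zero_of_forall_map_fibreIncl_eq_zero R M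
      (stdInfPt_mem F hF) y ?_ fun u ↦ ?_
    · -- the slice through `[f₀' : 0]` is the section at infinity
      have hc : ((stdLocalHomeomorph hF e hS).symm : C(↥S × ℙ ℂ (ULift.{u} ℂ × ℂ), ↥(complPreimage F E S))).comp
          (sliceAt (stdInfPt F hF)) = complInfOn F E hF S := by
        rw [← stdLocalHomeomorph_comp_complInfOn hF e hS, ← ContinuousMap.comp_assoc,
          Homeomorph.symm_comp_toContinuousMap, ContinuousMap.id_comp]
      rw [hy, ← ModuleCat.comp_apply, ← singularCohomology.map_comp, hc, hinf]
    · -- the fibre slice is the fibre of `P(λ ⊕ ℂ)` up to the homeomorphism `ℙ((e_b ≫ std) × 𝟙)`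
      obtain ⟨b, hb⟩ := u
      have hc : ((stdLocalHomeomorph hF e hS).symm : C(↥S × ℙ ℂ (ULift.{u} ℂ × ℂ), ↥(complPreimage F E S))).comp
          (fibreIncl (⟨b, hb⟩ : ↥S)) =
            (complFibOn hb).comp ((homeomorphOfContinuousLinearEquiv
              (((linEquivAt ℂ F E e b).trans (stdEquiv F hF)).prodCongr (ContinuousLinearEquiv.refl ℂ ℂ))).symm :
                C(ℙ ℂ (ULift.{u} ℂ × ℂ), ℙ ℂ (E b × ℂ))) := by
        ext1 ℓ
        apply (stdLocalHomeomorph hF e hS).injective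
        change stdLocalHomeomorph hF e hS ((stdLocalHomeomorph hF e hS).symm (⟨b, hb⟩, ℓ)) =
          stdLocalHomeomorph hF e hS ⟨⟨b, (homeomorphOfContinuousLinearEquiv
            (((linEquivAt ℂ F E e b).trans (stdEquiv F hF)).prodCongr (ContinuousLinearEquiv.refl ℂ ℂ))).symm ℓ⟩, hb⟩
        rw [Homeomorph.apply_symm_apply, stdLocalHomeomorph_apply_mk hF e hS hb]
        exact Prod.ext rfl ((homeomorphOfContinuousLinearEquiv _).apply_symm_apply ℓ).symm
      rw [hy, ← ModuleCat.comp_apply, ← singularCohomology.map_comp, hc, singularCohomology.map_comp,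
        ModuleCat.comp_apply, hfib b hb, map_zero]
  have hx : x = singularCohomology.map R M
      (stdLocalHomeomorph hF e hS : C(↥(complPreimage F E S), ↥S × ℙ ℂ (ULift.{u} ℂ × ℂ))) 2 y := by
    rw [hy, ← ModuleCat.comp_apply, ← singularCohomology.map_comp, Homeomorph.symm_comp_toContinuousMap,
      singularCohomology.map_id]
    rfl
  rw [hx, hy0, map_zero]

/-- **Uniqueness over a trivialisable `S`**: two normalised classes over `S ⊆ U_e` coincide.
[cite: MilnorStasheff1974, §10 Thm. 10.4] -/
theorem IsNormalised.unique {S : Set B} (hS : S ⊆ e.baseSet) {m : M}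
    {x x' : singularCohomology R M ↥(complPreimage F E S) 2}
    (hx : IsNormalised F E hF R M S m x) (hx' : IsNormalised F E hF R M S m x') : x = x' := by
  obtain ⟨h1, h2⟩ := hx.sub hF hx'
  exact sub_eq_zero.1 (eq_zero_of_map_complInfOn_eq_zero hF e hS (x - x') h1 h2)

/-- Over a trivialisable `S`, a normalised class IS the local Thom class. [cite: MilnorStasheff1974, §10 Thm. 10.4] -/
theorem IsNormalised.eq_localThomClass {S : Set B} (hS : S ⊆ e.baseSet) {m : M}
    {x : singularCohomology R M ↥(complPreimage F E S) 2} (hx : IsNormalised F E hF R M S m x) :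
    x = localThomClass hF R M e hS m :=
  hx.unique hF e hS (isNormalised_localThomClass hF e hS m)

/-- The local Thom classes restrict to local Thom classes. [folklore] -/
theorem map_complPreimageIncl_localThomClass {S' S : Set B} (h : S' ⊆ S) (hS : S ⊆ e.baseSet) (m : M) :
    singularCohomology.map R M (complPreimageIncl h) 2 (localThomClass hF R M e hS m) =
      localThomClass hF R M e (h.trans hS) m :=
  ((isNormalised_localThomClass hF e hS m).restrict hF h).eq_localThomClass hF e (h.trans hS)

/-- **Local Thom classes of two atlas trivialisations agree on `S ⊆ U_e ∩ U_{e'}`.** [cite: MilnorStasheff1974, §10 Thm. 10.4] -/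
theorem localThomClass_eq_localThomClass (e' : Trivialization F (π F E)) [MemTrivializationAtlas e'] {S : Set B}
    (hS : S ⊆ e.baseSet) (hS' : S ⊆ e'.baseSet) (m : M) :
    localThomClass hF R M e hS m = localThomClass hF R M e' hS' m :=
  (isNormalised_localThomClass hF e hS m).eq_localThomClass hF e' hS'

end Local

end Literature.AlgebraicTopology.CharacteristicClasses
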